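import Literature.Computability.Complexity.Mod2SystemEquiv
import Literature.Computability.Complexity.Mod2PerfectMatchings
import Literature.Computability.Complexity.MatchingDerivations
import Literature.Combinatorics.Optimization.SymmetricSDPMatching
import HarnessLib

/-!
# Vertex permutations acting on polynomials in the edge variables of `K_n` (BBCHPRRWZ 2017, §4.3–4.4)

Braun–Brown-Cohen–Huq–Pokutta–Raghavendra–Roy–Weitz–Zink, *The matching problem has no small
symmetric SDP*, Math. Program. 165 (2017), §4.3–4.4, use throughout the action `F ↦ σF` of a vertex
permutation `σ ∈ S_n` on `ℝ[x_{uv}]` (`x_{uv} ↦ x_{σu σv}`; Lemma 4.7 "`Σ_{σ ∈ S_n} σF`", the Claim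
in the proof of Thm 4.9 "`F ≅ σF`"), and in Lemma 4.8 the embedding `K_{n-2} ⊂ K_n`. This file
provides, with the cell's names (HOME/pnp-psdrank-p2/Sketch-v2.lean §2c, verbatim definitions):

* `edgeMap f hf` — the edge map of an injective vertex map; `polyPerm σ` (= `rename (edgeMap σ)`),
  `polyEmbed ι`;
* `polyPerm` is an action (`polyPerm_one`, `polyPerm_mul`), preserves total degree
  (`totalDegree_polyPerm`), PERMUTES the matching constraints `𝒫_n` (`polyPerm_system`, through
  `Mod2On.Idx.congr` of `Mod2SystemEquiv.lean`), hence preserves degree-`d` congruences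
  (`IsCong.perm`) and derivations, and preserves vanishing on perfect matchings
  (`eval_edgeIndicator_polyPerm`, `vanishes_polyPerm`).

## References

* G. Braun et al., *The matching problem has no small symmetric SDP*, Math. Program. 165 (2017)
  643–662, §4.3 (Lemma 4.7), §4.4 (Thm 4.9, Lemma 4.8) (arXiv:1504.00703, pp. 8–9). [BraunEtAl2016]
-/

noncomputable section

open MvPolynomial Finset
open Literature.Barriers.PneNP (IsPMOn)
open Literature.Combinatorics.Optimization (isPMOn_univ_image_map)

namespace Literature.Computability.Complexity

/-! ### Edge maps and the action on polynomials -/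

/-- Injective vertex maps send edges to edges (non-diagonal pairs to non-diagonal pairs).
[cite: BraunEtAl2016, §4.3 (p. 8, "σF")] -/
theorem not_isDiag_map_of_injective {m n : ℕ} {f : Fin m → Fin n} (hf : Function.Injective f) :
    ∀ e : Sym2 (Fin m), ¬ e.IsDiag → ¬ (Sym2.map f e).IsDiag := by
  intro e
  induction e using Sym2.ind with
  | h a b => simp [hf.eq_iff]

/-- The edge map of an injective vertex map. [cite: BraunEtAl2016, §4.3 (p. 8)] -/
def edgeMap {m n : ℕ} (f : Fin m → Fin n) (hf : Function.Injective f) (e : KnEdge m) : KnEdge n :=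
  ⟨Sym2.map f (e : Sym2 (Fin m)), not_isDiag_map_of_injective hf e.1 e.2⟩

/-- Unfolding. [cite: BraunEtAl2016, §4.3 (p. 8)] -/
@[simp] theorem coe_edgeMap {m n : ℕ} (f : Fin m → Fin n) (hf : Function.Injective f) (e : KnEdge m) :
    ((edgeMap f hf e : KnEdge n) : Sym2 (Fin n)) = Sym2.map f (e : Sym2 (Fin m)) := rfl

/-- Edge maps are injective. [cite: BraunEtAl2016, §4.3 (p. 8)] -/
theorem edgeMap_injective {m n : ℕ} (f : Fin m → Fin n) (hf : Function.Injective f) :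
    Function.Injective (edgeMap f hf) := fun e e' h => by
  apply Subtype.ext
  exact Sym2.map.injective hf (congrArg Subtype.val h)

/-- **`σF`**: the vertex permutation `σ` acting on polynomials in the edge variables,
`x_{uv} ↦ x_{σu σv}`. [cite: BraunEtAl2016, §4.3 (p. 8, Lemma 4.7 "Σ_{σ ∈ S_n} σF")] -/
def polyPerm {n : ℕ} (σ : Equiv.Perm (Fin n)) :
    MvPolynomial (KnEdge n) ℝ →ₐ[ℝ] MvPolynomial (KnEdge n) ℝ :=
  MvPolynomial.rename (edgeMap σ σ.injective)

/-- `K_m ↪ K_n` on polynomials along a vertex embedding. [cite: BraunEtAl2016, Lemma 4.8 (p. 9, "identifying K_{n-4} with K_n ∖ {a,b,u,v}")] -/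
def polyEmbed {m n : ℕ} (ι : Fin m ↪ Fin n) :
    MvPolynomial (KnEdge m) ℝ →ₐ[ℝ] MvPolynomial (KnEdge n) ℝ :=
  MvPolynomial.rename (edgeMap ι ι.injective)

variable {n : ℕ}

/-- The edge map of a permutation is the edge bijection `KEdgeOn.congr σ` of `Mod2SystemEquiv`.
[cite: BraunEtAl2016, §4.3 (p. 8)] -/
theorem edgeMap_eq_congr (σ : Equiv.Perm (Fin n)) :
    edgeMap σ σ.injective = (KEdgeOn.congr σ : KnEdge n ≃ KnEdge n) := by
  funext e
  rfl

/-- On variables: `σ x_e = x_{σ e}`. [cite: BraunEtAl2016, §4.3 (p. 8)] -/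
@[simp] theorem polyPerm_X (σ : Equiv.Perm (Fin n)) (e : KnEdge n) :
    polyPerm σ (X e) = X (edgeMap σ σ.injective e) := by
  rw [polyPerm, rename_X]

/-- The identity acts trivially. [cite: BraunEtAl2016, §4.3 (p. 8)] -/
theorem polyPerm_one (F : MvPolynomial (KnEdge n) ℝ) : polyPerm (1 : Equiv.Perm (Fin n)) F = F := by
  have : edgeMap (n := n) (1 : Equiv.Perm (Fin n)) (1 : Equiv.Perm (Fin n)).injective = id := by
    funext e; apply Subtype.ext; simp [edgeMap]
  rw [polyPerm, this, rename_id]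
  rfl

/-- The action is multiplicative: `(στ)F = σ(τF)`. [cite: BraunEtAl2016, §4.3 (p. 8)] -/
theorem polyPerm_mul (σ τ : Equiv.Perm (Fin n)) (F : MvPolynomial (KnEdge n) ℝ) :
    polyPerm (σ * τ) F = polyPerm σ (polyPerm τ F) := by
  have h : edgeMap (⇑(σ * τ)) (σ * τ).injective = edgeMap σ σ.injective ∘ edgeMap τ τ.injective := by
    funext e
    apply Subtype.ext
    simp [edgeMap, Equiv.Perm.coe_mul, Sym2.map_map]
  rw [polyPerm, polyPerm, polyPerm, rename_rename, h]

/-- `σ⁻¹` undoes `σ`. [cite: BraunEtAl2016, §4.3 (p. 8)] -/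
theorem polyPerm_inv_apply (σ : Equiv.Perm (Fin n)) (F : MvPolynomial (KnEdge n) ℝ) :
    polyPerm σ⁻¹ (polyPerm σ F) = F := by
  rw [← polyPerm_mul, inv_mul_cancel, polyPerm_one]

/-- `σ` undoes `σ⁻¹`. [cite: BraunEtAl2016, §4.3 (p. 8)] -/
theorem polyPerm_apply_inv (σ : Equiv.Perm (Fin n)) (F : MvPolynomial (KnEdge n) ℝ) :
    polyPerm σ (polyPerm σ⁻¹ F) = F := by
  rw [← polyPerm_mul, mul_inv_cancel, polyPerm_one]

/-- **Degrees are preserved.** [cite: BraunEtAl2016, §4.4 (p. 9, "σF" of the same degree)] -/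
theorem totalDegree_polyPerm (σ : Equiv.Perm (Fin n)) (F : MvPolynomial (KnEdge n) ℝ) :
    (polyPerm σ F).totalDegree = F.totalDegree := by
  apply le_antisymm (totalDegree_rename_le _ _)
  conv_lhs => rw [← polyPerm_inv_apply σ F]
  exact totalDegree_rename_le _ _

/-! ### The matching constraints are permuted -/

/-- **`𝒫_n` is `S_n`-stable**: `σ` carries the equation with index `ι` to the equation with index
`Idx.congr σ ι`. [cite: BraunEtAl2016, §4.2 (p. 7, 𝒫_n is symmetric under vertex permutations)] -/
theorem polyPerm_system (σ : Equiv.Perm (Fin n)) (ι : Mod2.Idx n) :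
    polyPerm σ (Mod2.system n ι) = Mod2.system n (Mod2On.Idx.congr σ ι) := by
  rw [polyPerm, edgeMap_eq_congr]
  have h := Mod2On.system_rename (P := Fin n) (Q := Fin n) σ ι
  rw [show Mod2On.system (Fin n) = Mod2.system n from (Mod2.system_eq_mod2On n).symm] at h
  exact h

/-- **Congruences are transported by the action**: `F ≅_d G ⇒ σF ≅_d σG`.
[cite: BraunEtAl2016, §4.4 (p. 9, proof of the Claim)] -/
theorem IsCong.perm (σ : Equiv.Perm (Fin n)) {d : ℕ} {F G : MvPolynomial (KnEdge n) ℝ}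
    (h : IsCong (Mod2.system n) d F G) : IsCong (Mod2.system n) d (polyPerm σ F) (polyPerm σ G) := by
  obtain ⟨q, hq, hFG⟩ := h
  set e : Mod2.Idx n ≃ Mod2.Idx n := Mod2On.Idx.congr (P := Fin n) (Q := Fin n) σ with he
  refine ⟨fun k => polyPerm σ (q (e.symm k)), fun k => ?_, ?_⟩
  · have : polyPerm σ (q (e.symm k)) * Mod2.system n k =
        polyPerm σ (q (e.symm k) * Mod2.system n (e.symm k)) := by
      rw [map_mul, polyPerm_system, he, Equiv.apply_symm_apply]
    rw [this, totalDegree_polyPerm]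
    exact hq _
  · have h2 := congrArg (polyPerm σ) hFG
    rw [map_add, map_sum] at h2
    rw [← h2]
    congr 1
    rw [← e.sum_comp]
    refine sum_congr rfl fun i _ => ?_
    dsimp only
    rw [e.symm_apply_apply, map_mul, polyPerm_system]

/-- Derivations are transported by the action. [cite: BraunEtAl2016, §4.4 (p. 9)] -/
theorem HasDerivationOfDegree.perm (σ : Equiv.Perm (Fin n)) {d : ℕ}
    {F : MvPolynomial (KnEdge n) ℝ} (h : HasDerivationOfDegree (Mod2.system n) F d) :
    HasDerivationOfDegree (Mod2.system n) (polyPerm σ F) d := by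
  rw [← isCong_zero_left_iff] at h ⊢
  have := h.perm σ
  rwa [map_zero] at this

/-! ### Vanishing on perfect matchings is preserved -/

/-- `s ∈ σ⁻¹·M ↔ σ·s ∈ M`. [cite: BraunEtAl2016, §4.1 (p. 7, the action σ·M on perfect matchings)] -/
theorem mem_image_map_inv_iff (σ : Equiv.Perm (Fin n)) (M : Finset (Sym2 (Fin n))) (s : Sym2 (Fin n)) :
    s ∈ M.image (Sym2.map ⇑σ⁻¹) ↔ Sym2.map σ s ∈ M := by
  constructor
  · intro h
    obtain ⟨t, ht, rfl⟩ := mem_image.1 h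
    rw [Sym2.map_map, Equiv.Perm.inv_def, Equiv.self_comp_symm, Sym2.map_id]
    exact ht
  · intro h
    refine mem_image.2 ⟨_, h, ?_⟩
    rw [Sym2.map_map, Equiv.Perm.inv_def, Equiv.symm_comp_self, Sym2.map_id]
    rfl

/-- `χ^M ∘ (edge map of σ) = χ^{σ⁻¹ M}`. [cite: BraunEtAl2016, §4.1 (p. 7)] -/
theorem edgeIndicator_comp_edgeMap (σ : Equiv.Perm (Fin n)) (M : Finset (Sym2 (Fin n))) :
    edgeIndicator M ∘ edgeMap σ σ.injective = edgeIndicator (M.image (Sym2.map ⇑σ⁻¹)) := by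
  funext e
  simp only [Function.comp_apply, edgeIndicator_apply, coe_edgeMap]
  exact if_congr (mem_image_map_inv_iff σ M e).symm rfl rfl

/-- **Evaluation at a perfect matching commutes with the action**: `(σF)(χ^M) = F(χ^{σ⁻¹M})`.
[cite: BraunEtAl2016, §4.1 (p. 7, "(g · h)(M) = h(g⁻¹ · M)")] -/
theorem eval_edgeIndicator_polyPerm (σ : Equiv.Perm (Fin n)) (M : Finset (Sym2 (Fin n)))
    (F : MvPolynomial (KnEdge n) ℝ) :
    eval (edgeIndicator M) (polyPerm σ F) = eval (edgeIndicator (M.image (Sym2.map ⇑σ⁻¹))) F := by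
  rw [polyPerm, eval_rename, edgeIndicator_comp_edgeMap]

/-- **Vanishing on perfect matchings is `S_n`-stable.** [cite: BraunEtAl2016, §4.4 (p. 9, σF ∈ ⟨𝒫_n⟩)] -/
theorem vanishes_polyPerm (σ : Equiv.Perm (Fin n)) {F : MvPolynomial (KnEdge n) ℝ}
    (hF : ∀ M : Finset (Sym2 (Fin n)), IsPMOn univ M → eval (edgeIndicator M) F = 0)
    (M : Finset (Sym2 (Fin n))) (hM : IsPMOn univ M) : eval (edgeIndicator M) (polyPerm σ F) = 0 := by
  rw [eval_edgeIndicator_polyPerm]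
  exact hF _ (isPMOn_univ_image_map σ⁻¹ hM)

/-- Congruent polynomials take the same values on perfect matchings.
[cite: BraunEtAl2016, §4.2 (p. 7, "F ≡ G: defining the same function on perfect matchings")] -/
theorem IsCong.eval_edgeIndicator_eq {d : ℕ} {F G : MvPolynomial (KnEdge n) ℝ}
    (h : IsCong (Mod2.system n) d F G) {M : Finset (Sym2 (Fin n))} (hM : IsPMOn univ M) :
    eval (edgeIndicator M) F = eval (edgeIndicator M) G := by
  obtain ⟨q, -, hFG⟩ := h
  rw [← hFG, map_add, map_sum]
  simp only [map_mul, Mod2.eval_system_edgeIndicator hM, mul_zero, sum_const_zero, add_zero]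

/-- `S_n` is generated by transpositions: to prove an `S_n`-closed property of the action it
suffices to treat swaps (Mathlib's `Equiv.Perm.swap_induction_on`, recorded in the form used for
the Claim of Thm 4.9: "it is enough to prove the claim when σ is a transposition").
[cite: BraunEtAl2016, §4.4 (p. 9)] -/
theorem polyPerm_induction_on_swaps {P : MvPolynomial (KnEdge n) ℝ → MvPolynomial (KnEdge n) ℝ → Prop}
    (hrefl : ∀ F, P F F) (htrans : ∀ F G H, P F G → P G H → P F H)
    (hswap : ∀ (F : MvPolynomial (KnEdge n) ℝ) (a b : Fin n), a ≠ b → P F (polyPerm (Equiv.swap a b) F))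
    (hperm : ∀ (σ : Equiv.Perm (Fin n)) F G, P F G → P (polyPerm σ F) (polyPerm σ G))
    (σ : Equiv.Perm (Fin n)) (F : MvPolynomial (KnEdge n) ℝ) : P F (polyPerm σ F) := by
  induction σ using Equiv.Perm.swap_induction_on generalizing F with
  | one => rw [polyPerm_one]; exact hrefl F
  | swap_mul σ a b hab ih =>
    rw [polyPerm_mul]
    -- `F ~ swap F ~ swap (σ ... )`? use: P F (σF) then apply swap: P (swap F) (swap σ F); and P F (swap F)
    exact htrans _ _ _ (hswap F a b hab) (hperm _ _ _ (ih F))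

end Literature.Computability.Complexity
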